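import Summits.AnomalousDissipation.AnomalousDissipation.Theses.MirrorEnsemble
import Summits.AnomalousDissipation.AnomalousDissipation.Theorems.EnsembleRigidityEnsembleFloorTransfer
import Literature.Analysis.FluidPDE.TimeAverageMeasureBasic
import HarnessLib

/-!
# Route MirrorEnsemble — the support item `FloorTransferOnSupport`

Proof of the route declaration
`Summit.AnomalousDissipation.AnomalousDissipation.Theses.MirrorEnsemble.FloorTransferOnSupport`
(item stmt-AnomalousDissipation-17696): the K-SUPPORTED ENSEMBLE FLOOR ⇒ PATH FLOOR transfer, a
hypothesis (`h₁`) of the route's deciding theorem `MirrorEnsemble.closes`. For `ν > 0`, a smooth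
force `f` on `T³` and ANY set `S ⊆ H`: if every stationary statistical solution `μ` of NS_ν(f)
(FMRT 2001, Ch. IV Def. 1.3) with integrable energy, `ensembleEnergy μ ≤ E` and `μ((closure S)ᶜ) = 0`
has `ensembleDissipation ν μ ≥ ε₀`, then every global Leray–Hopf path `u` with an `H`-valued lift
`U` (`U t = u t` a.e., `t ≥ 0`) that stays in `S` for `t ≥ 0` and has `meanEnergy u ≤ E` satisfies
`meanDissipation ν u ≥ ε₀`.

This is the landed unsupported transfer
`Summit.AnomalousDissipation.AnomalousDissipation.Theorems.meanDissipation_ge_of_ensembleFloor_of_generalizedLimit`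
(`Theorems/EnsembleRigidityEnsembleFloorTransfer.lean`, route EnsembleRigidity, item
stmt-AnomalousDissipation-15511) with ONE extra step: the time-average measure `μ` of the lift `U`
for a generalized limit `Λ` (`Theorems.exists_isTimeAverageMeasure_of_memLp`) is carried by
`closure S`, because the trajectory stays in the closed set `closure S` from time `0` on
(`Torus.IsTimeAverageMeasure.measure_compl_eq_zero`, FMRT p. 209: "clearly `μ(H ∖ K) = 0`"). The
rest is verbatim: `μ` is an SSS (the three proved conjuncts of `Torus.IsTimeAverageMeasure`), `‖v‖²`
is `μ`-integrable with `ensembleEnergy μ = Λ(energy means)` (`integral_eq_of_eqOn` on the carrying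
ball `IsGlobalLerayHopf.exists_forall_lift_mem_closedBall`), so if `Λ(energy means) ≤ E` the floor
fires at `μ`, and `ε₀ ≤ ensembleDissipation ν μ = ν (∫‖∇v‖² dμ).toReal ≤ ν Λ(enstrophy means)
≤ ν limsup(enstrophy means) = meanDissipation ν u` (`ensembleEnstrophy_le_ofReal_longTimeAvg`,
`GeneralizedLimit.le_limsup`, `longTimeAvgSup_const_mul`); finally ANY generalized limit has
`Λ(energy means) ≤ limsup = meanEnergy u ≤ E`.

Design: the proof lives in its own file so that the route file `Theses/MirrorEnsemble.lean` keeps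
its small import cone (rev 1 cone repair); nothing here is new mathematics.

## References

* C. Foias, O. Manley, R. Rosa, R. Temam, *Navier–Stokes Equations and Turbulence* (CUP 2001),
  Ch. IV §1.3 Def. 1.4 (generalized limits), §3.1 Def. 3.1, Prop. 3.1 (support of time-average
  measures), Cor. 3.1, Thm. 3.1 and the proof of (1.29) via (3.3)–(3.4), pp. 208–211.
  [FoiasManleyRosaTemam2001]
* C. Foias, R. M. S. Rosa, R. Temam, *A note on statistical solutions of the three-dimensional
  Navier–Stokes equations: the stationary case*, C. R. Math. 348 (2010) 347–353 (time-average
  stationary statistical solutions of Leray–Hopf solutions). [FoiasRosaTemam2010]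
-/

noncomputable section

open MeasureTheory Set Filter Topology
open scoped ENNReal NNReal

-- `Summit.<Summit>.<Problem>` is the tree's mandated summit-side namespace (CONVENTIONS §2); for
-- this single-conjunct summit the two coincide, so the duplicate is deliberate.
set_option linter.dupNamespace false

namespace Summit.AnomalousDissipation.AnomalousDissipation.Theorems

open Literature.Analysis Literature.Analysis.FluidPDE Literature.Analysis.FunctionSpaces
open Literature.Analysis.FluidPDE.Torus

/-- **Core supported transfer, one generalized limit `Λ` fixed.** If the ensemble floor holds at
level `E` for stationary statistical solutions carried by `closure S`, the lift `U` stays in `S`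
for `t ≥ 0`, and `Λ` assigns the energy means of the lift a value `≤ E`, then
`ε₀ ≤ meanDissipation ν u`. The time-average measure of `U` for `Λ` is carried by `closure S`
(FMRT 2001, Ch. IV Prop. 3.1), and the rest is the unsupported transfer
`meanDissipation_ge_of_ensembleFloor_of_generalizedLimit` verbatim.
[cite: FoiasManleyRosaTemam2001, Ch. IV §3.1 Prop. 3.1, Thm. 3.1, (3.3)–(3.4)] -/
theorem meanDissipation_ge_of_ensembleFloorOn_of_generalizedLimit {ν E ε₀ : ℝ} (hν : 0 < ν)
    {f u₀ : UnitAddTorus (Fin 3) → EuclideanSpace ℝ (Fin 3)} (hF : MemLp f 2 volume)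
    {S : Set (FunctionSpaces.Torus.energySpace (Fin 3))}
    (hfloor : ∀ μ : Measure (FunctionSpaces.Torus.energySpace (Fin 3)),
      IsStationaryStatisticalSolution ν f μ →
        Integrable (fun v : FunctionSpaces.Torus.energySpace (Fin 3) => ‖v‖ ^ 2) μ →
          ensembleEnergy μ ≤ E → μ (closure S)ᶜ = 0 → ε₀ ≤ ensembleDissipation ν μ)
    {u : ℝ → UnitAddTorus (Fin 3) → EuclideanSpace ℝ (Fin 3)}
    (hu : IsGlobalLerayHopf ν (fun _ => f) u₀ u)
    {U : ℝ → FunctionSpaces.Torus.energySpace (Fin 3)}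
    (hU : ∀ t, 0 ≤ t →
      (((U t : Lp (EuclideanSpace ℝ (Fin 3)) 2 (volume : Measure (UnitAddTorus (Fin 3)))) :
        UnitAddTorus (Fin 3) → EuclideanSpace ℝ (Fin 3))) =ᵐ[volume] u t)
    (hUS : ∀ t, 0 ≤ t → U t ∈ S)
    (Λ : GeneralizedLimit) (hΛE : Λ (timeMean fun s => ‖U s‖ ^ 2) ≤ E) :
    ε₀ ≤ meanDissipation ν u := by
  -- the carrying ball
  obtain ⟨ρ, hρ0, hρ⟩ := hu.exists_forall_lift_mem_closedBall hν hF hU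
  have hball : ∀ t, 0 ≤ t → ‖U t‖ ^ 2 ≤ ρ := fun t ht => (hρ t ht).1
  -- a time-average measure for `Λ`, which is an SSS of NS_ν(f)
  obtain ⟨μ, hμ⟩ := exists_isTimeAverageMeasure_of_memLp hν hF hu hU Λ
  have hstat : IsStationaryStatisticalSolution ν f μ :=
    ⟨hμ.1, IsTimeAverageMeasure.lintegral_eGradNormSq_lt_top hν hF hu hU hμ,
      fun Φ => IsTimeAverageMeasure.integrable_generator_and_integral_eq_zero hν hF hu hU hμ Φ,
      fun e₁ e₂ he => IsTimeAverageMeasure.energy_ineq_shell hν hF hu hU hμ e₁ e₂ he⟩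
  -- support: the trajectory stays in the closed set `closure S` from time `0` on, so `μ` is
  -- carried by `closure S` (FMRT Prop. 3.1)
  have hsupp : μ (closure S)ᶜ = 0 :=
    hμ.measure_compl_eq_zero isClosed_closure le_rfl fun t ht => subset_closure (hUS t ht)
  -- energy side: integrable, and `ensembleEnergy μ = Λ(energy means) ≤ E`
  have hKc : IsClosed {v : FunctionSpaces.Torus.energySpace (Fin 3) | ‖v‖ ^ 2 ≤ ρ} :=
    isClosed_le (continuous_norm.pow 2) continuous_const
  have hUK : ∀ t, 0 ≤ t → U t ∈ {v : FunctionSpaces.Torus.energySpace (Fin 3) | ‖v‖ ^ 2 ≤ ρ} :=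
    fun t ht => hball t ht
  have hΨc : Continuous fun v : FunctionSpaces.Torus.energySpace (Fin 3) => min (‖v‖ ^ 2) ρ :=
    (continuous_norm.pow 2).min continuous_const
  have hΨb : ∀ v : FunctionSpaces.Torus.energySpace (Fin 3), |min (‖v‖ ^ 2) ρ| ≤ ρ := fun v => by
    rw [abs_of_nonneg (le_min (sq_nonneg _) hρ0)]
    exact min_le_right _ _
  have heq : EqOn (fun v : FunctionSpaces.Torus.energySpace (Fin 3) => ‖v‖ ^ 2)
      (fun v => min (‖v‖ ^ 2) ρ) {v | ‖v‖ ^ 2 ≤ ρ} := fun v hv => (min_eq_left hv).symm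
  obtain ⟨hint, hI⟩ := hμ.integral_eq_of_eqOn hKc hUK hΨc hΨb heq
  have h1 : ensembleEnergy μ = Λ (timeMean fun s => ‖U s‖ ^ 2) := hI
  have hEμ : ensembleEnergy μ ≤ E := h1 ▸ hΛE
  -- the supported floor, instantiated at `μ`
  have hfl : ε₀ ≤ ensembleDissipation ν μ := hfloor μ hstat hint hEμ hsupp
  -- dissipation side:
  -- `ν ∫‖∇v‖² dμ ≤ ν Λ(enstrophy means) ≤ ν limsup(enstrophy means) = meanDissipation`
  set k : ℝ → ℝ := fun t => (FunctionSpaces.Torus.eGradNormSq (u t)).toReal with hk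
  have hle : ensembleEnstrophy μ ≤ ENNReal.ofReal (Λ.longTimeAvg k) :=
    ensembleEnstrophy_le_ofReal_longTimeAvg hν hF hu hU hμ
  have hkb₁ : IsBoundedUnder (· ≤ ·) atTop (timeMean k) :=
    ⟨_, (eventually_ge_atTop 1).mono fun T hT => hu.timeMean_enstrophy_le hν hF hU hT⟩
  have hk0 : ∀ᶠ T in atTop, 0 ≤ timeMean k T := by
    filter_upwards [eventually_gt_atTop 0] with T hT
    unfold timeMean
    exact mul_nonneg (inv_nonneg.2 hT.le)
      (intervalIntegral.integral_nonneg hT.le fun t _ => ENNReal.toReal_nonneg)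
  have hkb₂ : IsBoundedUnder (· ≥ ·) atTop (timeMean k) := ⟨0, hk0⟩
  have hΛ0 : 0 ≤ Λ.longTimeAvg k := Λ.le_apply_of_eventually_le hkb₁ hk0
  have hΛk : Λ.longTimeAvg k ≤ longTimeAvgSup k := Λ.le_limsup hkb₁ hkb₂
  have htoReal : (ensembleEnstrophy μ).toReal ≤ Λ.longTimeAvg k :=
    ENNReal.toReal_le_of_le_ofReal hΛ0 hle
  have hdiss : meanDissipation ν u = ν * longTimeAvgSup k := by
    unfold meanDissipation
    exact longTimeAvgSup_const_mul hν.le k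
  calc ε₀ ≤ ensembleDissipation ν μ := hfl
    _ = ν * (ensembleEnstrophy μ).toReal := rfl
    _ ≤ ν * Λ.longTimeAvg k := mul_le_mul_of_nonneg_left htoReal hν.le
    _ ≤ ν * longTimeAvgSup k := mul_le_mul_of_nonneg_left hΛk hν.le
    _ = meanDissipation ν u := hdiss.symm

/-- **Supported ensemble dissipation floors reach every lifted Leray–Hopf path staying in `S`**
(the item for `f ∈ L²`): ANY generalized limit works, since
`Λ(energy means) ≤ limsup = meanEnergy u ≤ E`.
[cite: FoiasManleyRosaTemam2001, Ch. IV §3.1 Prop. 3.1, Thm. 3.1, (3.3)–(3.4)] -/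
theorem meanDissipation_ge_of_ensembleFloorOn {ν E ε₀ : ℝ} (hν : 0 < ν)
    {f u₀ : UnitAddTorus (Fin 3) → EuclideanSpace ℝ (Fin 3)} (hF : MemLp f 2 volume)
    {S : Set (FunctionSpaces.Torus.energySpace (Fin 3))}
    (hfloor : ∀ μ : Measure (FunctionSpaces.Torus.energySpace (Fin 3)),
      IsStationaryStatisticalSolution ν f μ →
        Integrable (fun v : FunctionSpaces.Torus.energySpace (Fin 3) => ‖v‖ ^ 2) μ →
          ensembleEnergy μ ≤ E → μ (closure S)ᶜ = 0 → ε₀ ≤ ensembleDissipation ν μ)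
    {u : ℝ → UnitAddTorus (Fin 3) → EuclideanSpace ℝ (Fin 3)}
    (hu : IsGlobalLerayHopf ν (fun _ => f) u₀ u)
    {U : ℝ → FunctionSpaces.Torus.energySpace (Fin 3)}
    (hU : ∀ t, 0 ≤ t →
      (((U t : Lp (EuclideanSpace ℝ (Fin 3)) 2 (volume : Measure (UnitAddTorus (Fin 3)))) :
        UnitAddTorus (Fin 3) → EuclideanSpace ℝ (Fin 3))) =ᵐ[volume] u t)
    (hUS : ∀ t, 0 ≤ t → U t ∈ S) (hE : meanEnergy u ≤ E) :
    ε₀ ≤ meanDissipation ν u := by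
  obtain ⟨ρ, _hρ0, hρ⟩ := hu.exists_forall_lift_mem_closedBall hν hF hU
  have hgabs : ∀ t, 0 < t → |(fun s => ‖U s‖ ^ 2) t| ≤ ρ := fun t ht => by
    rw [abs_of_nonneg (sq_nonneg _)]
    exact (hρ t ht.le).1
  have hb₁ : IsBoundedUnder (· ≤ ·) atTop (timeMean fun s => ‖U s‖ ^ 2) :=
    isBoundedUnder_le_timeMean hgabs
  have hb₂ : IsBoundedUnder (· ≥ ·) atTop (timeMean fun s => ‖U s‖ ^ 2) :=
    isBoundedUnder_ge_timeMean hgabs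
  obtain ⟨Λ⟩ := (GeneralizedLimit.nonempty_holds : GeneralizedLimit.nonempty)
  have h2 : meanEnergy u = limsup (timeMean fun s => ‖U s‖ ^ 2) atTop := by
    rw [meanEnergy_eq_longTimeAvgSup]
    unfold longTimeAvgSup
    refine limsup_congr (timeMean_eventuallyEq fun t ht => ?_)
    rw [integral_norm_sq_eq_norm_lift_sq hU ht.le, Submodule.coe_norm]
  have hΛE : Λ (timeMean fun s => ‖U s‖ ^ 2) ≤ E :=
    (Λ.le_limsup hb₁ hb₂).trans (h2 ▸ hE)
  exact meanDissipation_ge_of_ensembleFloorOn_of_generalizedLimit hν hF hfloor hu hU hUS Λ hΛE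

/-! ### The route declaration, concluded BY NAME -/

/-- **`MirrorEnsemble.FloorTransferOnSupport`** (item stmt-AnomalousDissipation-17696): for `ν > 0`,
a smooth force `f` on `T³` and any `S ⊆ H`, if every stationary statistical solution of NS_ν(f)
with integrable energy, `ensembleEnergy ≤ E` and carried by `closure S` has
`ensembleDissipation ≥ ε₀`, then every global Leray–Hopf path `u` with an `H`-valued lift staying in
`S` for `t ≥ 0` and `meanEnergy u ≤ E` has `meanDissipation ν u ≥ ε₀`. Specialisation of
`meanDissipation_ge_of_ensembleFloorOn` to a smooth force (`Torus.IsSmooth.memLp`).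
[cite: FoiasManleyRosaTemam2001, Ch. IV §3.1 Prop. 3.1, Thm. 3.1, (3.3)–(3.4)] -/
theorem floorTransferOnSupport_proof :
    Summit.AnomalousDissipation.AnomalousDissipation.Theses.MirrorEnsemble.FloorTransferOnSupport := by
  unfold Summit.AnomalousDissipation.AnomalousDissipation.Theses.MirrorEnsemble.FloorTransferOnSupport
  intro ν E ε₀ f u₀ u U S hν hfs hfloor hu hU hUS hE
  exact meanDissipation_ge_of_ensembleFloorOn hν (hfs.memLp 2) hfloor hu hU hUS hE

end Summit.AnomalousDissipation.AnomalousDissipation.Theorems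

end
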